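import Literature.MathematicalPhysics.QuantumFieldTheory.Balaban1983to89.B9SectBGWordDeltaAY
import Literature.MathematicalPhysics.QuantumFieldTheory.Balaban1983to89.Node00.OpsYSectDQ

/-!
# Balaban [B9], (3.26)–(3.27) p. 395 at a GENERIC averaging pair `(𝔮, 𝔮s)` — the Sect.-B coded bond letters `QbQC ∕ QsbQC ∕ GbQC ∕ F₂QC ∕ F₂sQC` and
# ★★★ `conj_deltaAQY_eq`: node00-def-Y's `Δ_a[𝔮](U)` (`Node00.deltaAQY`, W-series `OpsYSectDQ`) IS r06's `deltaA` word of the G frames in real bond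
# coordinates; FIELDS `reg_ginv` ∕ `gb_eq_cplx` ∕ `qb_mul` of the G frames at these letters (CASCADE-K piece «K2-G», stage A)

T. Bałaban, *Propagators for lattice gauge theories in a background field*, Commun. Math. Phys. **99** (1985) 389–434
[`Balaban1985BackgroundPropagators`, "B9"]; T. Bałaban, *Averaging operations for lattice gauge theories*, Commun. Math. Phys. **98** (1985) 17–51
[`Balaban1985Averaging`, "B8"].

statement-level skeleton of published theorems with citation tags; proofs where landed; nothing here is a claim about the
Yang–Mills mass gap

THE PRINTED LOCUS (p. 395, (3.26)–(3.27)): *«Δ_a(U) = Δ(U) + D_U R(U) D*_U + Q*(U) a Q(U)»*, *«G(U) = Δ_a(U)⁻¹»*; the averaging operation `Q(U)` of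
(3.11)–(3.13) p. 393 is, in print, the operation of [B8] Prop. 2 p. 26 (the tree's «knit» letter `qKnitOfRecord`), of which the tree's «straight» letter
`QY parB` is the simplified reading.

WHY THIS FILE (seat dag-n06-c gen 25; cell INBOX 2026-08-30 «⚑ K2-G SCOPE»).  The landed Sect.-B G-side chain (`B9SectBGWordDeltaAY` → … →
`B9SectBStepUParGOfMembers.sectBStepUParG_of_members`, ✓) reads the bond letter `G = GAY par parB (GpY par) = GAQY (QY parB) (QsY parB) par (GpY par)`
(`Node00.GAQY_QY`, `rfl`); the knit certificate (dag-n06-d «KA» ✓, displayed row `hBK`) needs the same Sect.-B step at `G[𝔮] := GAQY 𝔮 𝔮s par (GpY par)`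
with `(𝔮, 𝔮s) := (qKnitOfRecord, qsKnitOfRecord)`.  The frame structures (`GFrame₅` …) are letter-generic; only the CODED LETTERS were typed at `QY`.  This
file is their generic edition, proofs VERBATIM from `B9SectBGWordDeltaAY` with `QY parB U ↦ 𝔮 U`, `QsY parB U ↦ 𝔮s U`, `deltaAY ↦ deltaAQY`, `GAY ↦ GAQY`:
§1 `QbQY 𝔮 U := ext ∘ 𝔮 U`, `QsbVQY 𝔮s U := 𝔮s U ∘ diag(vol) ∘ res` (print's volume rebalancing of `B9SectBGWordDeltaAY` kept, so the weight letter `abC`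
and its law are UNCHANGED), ★ `QsbVQY_comp_abVY_comp_QbQY` (`= 𝔮s U ∘ a ∘ 𝔮 U`), the coded letters `QbQC 𝔮 b c`, `QsbQC 𝔮s b c`; §2 ★★★ `conj_deltaAQY_eq`;
§3 `GbQC 𝔮 𝔮s parS b c := conj b (bondOpCoordsY (GAQY 𝔮 𝔮s parS (GpY parS) (decY c)))`, `F₂QC ∕ F₂sQC` ((3.80) differences at (base, multiplier)
pairs), ★ `word_mul_GbQC`, ★ `GbQC_eq_of_two_sided`, `qbQC_prod ∕ qsbQC_prod`; §4 the straight instance: `QbQC (QY parB) = QbC parB`, … , `GbQC (QY parB)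
(QsY parB) parS = GbC parS parB` — all `rfl`.

HONEST SCOPE.  Definitions (coordinate readings of node00-def-Y's generic letters; PROOF DEVICES of the Sect.-B chain, not letters of record — the record's
letters stay def-Y's `GAQY ∕ deltaAQY ∕ qKnitOfRecord`) and exact finite-dimensional identities; no estimate ((3.15) ∕ (3.80)–(3.81) sizes of `𝔮` are
DISPLAYED LAWS downstream); nothing of [B9] asserted; count-neutral; N06 NOT discharged; nothing continuum ∕ OS ∕ mass-gap ∕ Clay.  No `sorry`, no
`axiom`, no `instance`, no `notation`.  `--supports stmt-QuantumFields-27364`.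

RELATED IN THE TREE, NOT DUPLICATED: `B9SectBGWordDeltaAY` (the `QY` edition — its `volY ∕ abVY ∕ abC ∕ bondOpCoordsRY ∕ LapBC` and §2 sign lemmas are
USED, not restated), `Node00.OpsYSectDQ` (def-Y: `deltaAQY ∕ GAQY` and their `Ring.inverse` laws — USED), `Node00.OpsYCoarseBondRep`.
-/

noncomputable section

namespace Literature.MathematicalPhysics.QuantumFieldTheory.Balaban1983to89.B9SectBGWordDeltaAQY

open Literature.MathematicalPhysics.QuantumFieldTheory.Balaban1983to89
open Literature.MathematicalPhysics.QuantumFieldTheory.Balaban1983to89.B6KLevelCensusIndexV1 (KIdx)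
open Literature.MathematicalPhysics.QuantumFieldTheory.Balaban1983to89.B9Eq352DivFormLetters (conj coordEquiv)
open Literature.MathematicalPhysics.QuantumFieldTheory.Balaban1983to89.B9Cor36GpCubeEntriesAtV (conj_add')
open Literature.MathematicalPhysics.QuantumFieldTheory.Balaban1983to89.B9Eq376POneLetters (conjHom gradLin divLin)
open Literature.MathematicalPhysics.QuantumFieldTheory.Balaban1983to89.B9Eq372RemLetters (lapDDLetter)
open Literature.MathematicalPhysics.QuantumFieldTheory.Balaban1983to89.B9Eq382V3Letters (dPrimeLetter)
open Literature.MathematicalPhysics.QuantumFieldTheory.Balaban1983to89.B9Eq386Neumann (deltaA)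
open Literature.MathematicalPhysics.QuantumFieldTheory.Balaban1983to89.B9SectBCodedCarrier (CCfg)
open Literature.MathematicalPhysics.QuantumFieldTheory.Balaban1983to89.B9Eq360DeltaPrimeAY (AfldY)
open Literature.MathematicalPhysics.QuantumFieldTheory.Balaban1983to89.B9SectBGpLettersY (GopC decY conj_one)
open Literature.MathematicalPhysics.QuantumFieldTheory.Balaban1983to89.B9SectBKerLettersY (QcC QcsC CopC)
open Literature.MathematicalPhysics.QuantumFieldTheory.Balaban1983to89.B9SectBGWordDeltaAY (volY volY_pos abVY abC QsbVY QbC QsbC GbC F₂C F₂sC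
  restrictScalars_mul' restrictScalars_add' bondOpCoordsY_hessY conj_bondOpCoordsY_gradY_RY_divY)
open Literature.MathematicalPhysics.QuantumFieldTheory.Balaban1983to89.Node00 (SiteY FBondY IBondY CfgY SiteParY BondParY UboxY shiftY gradY divY GpY RY hessY
  QbY QsY QY aY aK liftMatY liftMatY_mul resBondY extBondY resBondY_comp_extBondY bondFunCoordsY bondOpCoordsY bondOpCoordsY_apply bondOpCoordsY_one
  aK_eq_diagonal deltaAQY GAQY deltaAQY_mul_GAQY GAQY_mul_deltaAQY)

variable {𝔸 : Type} [NormedRing 𝔸] [NormedAlgebra ℂ 𝔸] [CompleteSpace 𝔸]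
variable {d ℓ : ℕ} {hd : 1 ≤ d + 1} {hL : Odd (ℓ + 1) ∧ 1 < ℓ + 1} {b₀ b₁ : ℝ}
variable (i : KIdx d ℓ hd hL b₀ b₁) (𝔮 : CfgY 𝔸 i → ((FBondY i → 𝔸) →ₗ[ℂ] (IBondY i → 𝔸)))
  (𝔮s : CfgY 𝔸 i → ((IBondY i → 𝔸) →ₗ[ℂ] (FBondY i → 𝔸))) (parS : SiteParY 𝔸 i) (parB : BondParY 𝔸 i)
  {ι : Type} [Fintype ι] (b : Module.Basis ι ℝ 𝔸)

/-! ## §1 The letters `𝔮(U)`, `𝔮s(U)` read on fine bonds and in real bond coordinates — print's split of the block volume -/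

/-- **`𝔮(U)` read on fine bonds**: `QbQY := ext ∘ 𝔮(U)` (def-Y's `QbY` pattern at a generic letter). [cite: Balaban1985BackgroundPropagators, (3.12) p.393, dictionary] [cite: Balaban1985Averaging, Prop. 2 p.26] -/
def QbQY (U : CfgY 𝔸 i) : Module.End ℂ (FBondY i → 𝔸) := extBondY i ∘ₗ 𝔮 U

/-- **`𝔮s(U)` read on fine bonds, volume-weighted**: `QsbVQY := 𝔮s(U) ∘ diag(vol) ∘ res` (the `QsbVY` pattern at a generic adjoint letter).
[cite: Balaban1985BackgroundPropagators, (3.13) p.393, (3.26) p.395, dictionary] -/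
def QsbVQY (U : CfgY 𝔸 i) : Module.End ℂ (FBondY i → 𝔸) :=
  𝔮s U ∘ₗ liftMatY 𝔸 (Matrix.diagonal (volY i)) ∘ₗ resBondY i

/-- ★ THE REBALANCED TRIPLE IS PRINT'S THIRD TERM: `QsbVQY ∘ abVY ∘ QbQY = 𝔮s(U) ∘ a ∘ 𝔮(U)` (`res ∘ ext = id`, `diag(vol)·diag(w∕vol) = diag(w) = aK`).
[cite: Balaban1985BackgroundPropagators, (3.26) p.395] -/
theorem QsbVQY_comp_abVY_comp_QbQY (U : CfgY 𝔸 i) : QsbVQY i 𝔮s U ∘ₗ abVY i ∘ₗ QbQY i 𝔮 U = 𝔮s U ∘ₗ aY i ∘ₗ 𝔮 U := by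
  have hvol : Matrix.diagonal (volY i) * Matrix.diagonal (fun ι => i.w ι / volY i ι) = aK i := by
    rw [Matrix.diagonal_mul_diagonal, aK_eq_diagonal]
    congr 1; funext ι; rw [mul_div_cancel₀ _ (volY_pos i ι).ne']
  simp only [QsbVQY, abVY, QbQY, LinearMap.comp_assoc]
  rw [← LinearMap.comp_assoc (𝔮 U) (extBondY i) (resBondY i), resBondY_comp_extBondY, LinearMap.id_comp,
    ← LinearMap.comp_assoc (liftMatY 𝔸 (Matrix.diagonal fun ι => i.w ι / volY i ι) ∘ₗ 𝔮 U) (extBondY i) (resBondY i),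
    resBondY_comp_extBondY, LinearMap.id_comp, ← LinearMap.comp_assoc (𝔮 U), ← liftMatY_mul, hvol]
  rfl

/-- ★ `Δ_a[𝔮](U)` as a word in fine-bond endomorphisms with print's split of the third term: `deltaAQY = hessY + gradY∘RY∘divY + QsbVQY∘abVY∘QbQY`.
[cite: Balaban1985BackgroundPropagators, (3.26) p.395] -/
theorem deltaAQY_eq_fineBondWordV (Gp : Node00.SiteOpY 𝔸 i) (U : CfgY 𝔸 i) :
    deltaAQY i 𝔮 𝔮s parS Gp U = hessY i U + gradY i U ∘ₗ RY i parS Gp U ∘ₗ divY i U + QsbVQY i 𝔮s U ∘ₗ abVY i ∘ₗ QbQY i 𝔮 U := by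
  rw [QsbVQY_comp_abVY_comp_QbQY]; rfl

/-- **the letter `Qb = 𝔮(V)` read on fine bonds in real bond coordinates**, at every coded configuration (at its decoding).
[cite: Balaban1985BackgroundPropagators, (3.12) p.393, (3.26) p.395] [cite: Balaban1985Averaging, Prop. 2 p.26] -/
def QbQC (c : CCfg (CfgY 𝔸 i) (AfldY 𝔸 i)) : Module.End ℝ ((Fin (d + 1) × SiteY i) × ι → ℝ) :=
  conj b ((bondOpCoordsY i (QbQY i 𝔮 (decY i c))).restrictScalars ℝ)

/-- **the letter `Qsb = 𝔮s(V)`** (volume-weighted, `QsbVQY`) in real bond coordinates. [cite: Balaban1985BackgroundPropagators, (3.13) p.393, (3.26) p.395] -/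
def QsbQC (c : CCfg (CfgY 𝔸 i) (AfldY 𝔸 i)) : Module.End ℝ ((Fin (d + 1) × SiteY i) × ι → ℝ) :=
  conj b ((bondOpCoordsY i (QsbVQY i 𝔮s (decY i c))).restrictScalars ℝ)

/-- `QbQC` unfolded. [cite: Balaban1985BackgroundPropagators, (3.12) p.393, dictionary] -/
theorem QbQC_def (c : CCfg (CfgY 𝔸 i) (AfldY 𝔸 i)) : QbQC i 𝔮 b c = conj b ((bondOpCoordsY i (QbQY i 𝔮 (decY i c))).restrictScalars ℝ) := rfl

/-- `QsbQC` unfolded. [cite: Balaban1985BackgroundPropagators, (3.13) p.393, dictionary] -/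
theorem QsbQC_def (c : CCfg (CfgY 𝔸 i) (AfldY 𝔸 i)) : QsbQC i 𝔮s b c = conj b ((bondOpCoordsY i (QsbVQY i 𝔮s (decY i c))).restrictScalars ℝ) := rfl

/-! ## §2 ★★★ `Δ_a[𝔮](U)` is the frames' word -/

/-- ★★★ **NODE 00's `Δ_a[𝔮](U)` IS THE G FRAMES' `deltaA` WORD**: for every coded configuration `c` (real basis `b` of `𝔸`, transporter `parS`, averaging
pair `(𝔮, 𝔮s)`), in real bond coordinates `conj b (bondOpCoordsY (deltaAQY 𝔮 𝔮s parS (GpY parS) (decY c))) = deltaA (conj b (lapDDLetter (shiftY) |c_f| V))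
(conj b (dPrimeLetter (shiftY) V |c_f|⁻¹)) (conjHom b (gradLin (shiftY) |c_f| V) ∘ (1 − GopC c∘QcsC c∘CopC c∘QcC c∘GopC c) ∘ conjHom b (divLin (shiftY) |c_f| V))
(QsbQC c) abC (QbQC c)`, `V := UboxY (decY c)` — the proof of `B9SectBGWordDeltaAY.conj_deltaAY_eq` verbatim at the generic letters.
[cite: Balaban1985BackgroundPropagators, (3.26) p.395, (3.10) p.392, (3.25) p.394] -/
theorem conj_deltaAQY_eq (c : CCfg (CfgY 𝔸 i) (AfldY 𝔸 i)) :
    conj b ((bondOpCoordsY i (deltaAQY i 𝔮 𝔮s parS (GpY i parS) (decY i c))).restrictScalars ℝ) =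
      deltaA (conj b (lapDDLetter (shiftY i) ((|i.cf| : ℝ) : ℂ) (UboxY i (decY i c))))
        (conj b (dPrimeLetter (shiftY i) (UboxY i (decY i c)) (|i.cf|⁻¹)))
        (conjHom b (gradLin (shiftY i) ((|i.cf| : ℝ) : ℂ) (UboxY i (decY i c))) ∘ₗ
            (1 - GopC i parS b c ∘ₗ QcsC i parS b c ∘ₗ CopC i parS b c ∘ₗ QcC i parS b c ∘ₗ GopC i parS b c) ∘ₗ
          conjHom b (divLin (shiftY i) ((|i.cf| : ℝ) : ℂ) (UboxY i (decY i c))))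
        (QsbQC i 𝔮s b c) (abC i b) (QbQC i 𝔮 b c) := by
  rw [deltaAQY_eq_fineBondWordV, deltaA, ← conj_bondOpCoordsY_gradY_RY_divY, QsbQC, abC, QbQC]
  have hC : bondOpCoordsY i (QsbVQY i 𝔮s (decY i c) ∘ₗ abVY i ∘ₗ QbQY i 𝔮 (decY i c)) =
      bondOpCoordsY i (QsbVQY i 𝔮s (decY i c)) * (bondOpCoordsY i (abVY i) * bondOpCoordsY i (QbQY i 𝔮 (decY i c))) := by
    rw [← Node00.bondOpCoordsY_mul, ← Node00.bondOpCoordsY_mul]; rfl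
  rw [map_add, map_add, hC, restrictScalars_add', restrictScalars_add', restrictScalars_mul', restrictScalars_mul', conj_add', conj_add',
    B9Eq352DivFormLetters.conj_mul, B9Eq352DivFormLetters.conj_mul, bondOpCoordsY_hessY, conj_add', mul_assoc]

/-! ## §3 The remaining bond letters of the generic G-frame instance and their definitional laws -/

/-- **the letter `Gb = G[𝔮](V) = Δ_a[𝔮](V)⁻¹`** ((3.27); node00-def-Y's total `GAQY = Ring.inverse Δ_a[𝔮]`) in real bond coordinates, at every coded configuration.
[cite: Balaban1985BackgroundPropagators, (3.27) p.395, Thm 3.3 p.399] -/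
def GbQC (c : CCfg (CfgY 𝔸 i) (AfldY 𝔸 i)) : Module.End ℝ ((Fin (d + 1) × SiteY i) × ι → ℝ) :=
  conj b ((bondOpCoordsY i (GAQY i 𝔮 𝔮s parS (GpY i parS) (decY i c))).restrictScalars ℝ)

/-- **the (3.80) variation letter `F₂(A) = 𝔮(U′U) − 𝔮(U)`** at a (base `U`, multiplier `a`) pair, `0` at every other pair (the `F₂C` pattern).
[cite: Balaban1985BackgroundPropagators, (3.80) p.406] -/
def F₂QC : CCfg (CfgY 𝔸 i) (AfldY 𝔸 i) → CCfg (CfgY 𝔸 i) (AfldY 𝔸 i) → Module.End ℝ ((Fin (d + 1) × SiteY i) × ι → ℝ)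
  | .base U, .mult a => QbQC i 𝔮 b (.prod U a) - QbQC i 𝔮 b (.base U)
  | _, _ => 0

/-- **the (3.80) variation letter `F₂*(A) = 𝔮s(U′U) − 𝔮s(U)`** at a (base, multiplier) pair, `0` elsewhere. [cite: Balaban1985BackgroundPropagators, (3.80) p.406] -/
def F₂sQC : CCfg (CfgY 𝔸 i) (AfldY 𝔸 i) → CCfg (CfgY 𝔸 i) (AfldY 𝔸 i) → Module.End ℝ ((Fin (d + 1) × SiteY i) × ι → ℝ)
  | .base U, .mult a => QsbQC i 𝔮s b (.prod U a) - QsbQC i 𝔮s b (.base U)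
  | _, _ => 0

/-- FIELD `qb_mul`, first half: `𝔮(e^{iηa}U) = 𝔮(U) + F₂(a)` (by definition of `F₂QC`). [cite: Balaban1985BackgroundPropagators, (3.80) p.406] -/
theorem qbQC_prod (U : CfgY 𝔸 i) (a : AfldY 𝔸 i) : QbQC i 𝔮 b (.prod U a) = QbQC i 𝔮 b (.base U) + F₂QC i 𝔮 b (.base U) (.mult a) := by
  simp only [F₂QC, add_sub_cancel]

/-- FIELD `qb_mul`, second half: `𝔮s(e^{iηa}U) = 𝔮s(U) + F₂*(a)`. [cite: Balaban1985BackgroundPropagators, (3.80) p.406] -/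
theorem qsbQC_prod (U : CfgY 𝔸 i) (a : AfldY 𝔸 i) : QsbQC i 𝔮s b (.prod U a) = QsbQC i 𝔮s b (.base U) + F₂sQC i 𝔮s b (.base U) (.mult a) := by
  simp only [F₂sQC, add_sub_cancel]

/-- `Δ_a[𝔮] · G[𝔮] = 1` in real bond coordinates wherever `Δ_a[𝔮]` is a unit. [cite: Balaban1985BackgroundPropagators, (3.27) p.395] -/
theorem conj_deltaAQY_mul_GbQC (c : CCfg (CfgY 𝔸 i) (AfldY 𝔸 i)) (hU : IsUnit (deltaAQY i 𝔮 𝔮s parS (GpY i parS) (decY i c))) :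
    conj b ((bondOpCoordsY i (deltaAQY i 𝔮 𝔮s parS (GpY i parS) (decY i c))).restrictScalars ℝ) * GbQC i 𝔮 𝔮s parS b c = 1 := by
  rw [GbQC, ← B9Eq352DivFormLetters.conj_mul, ← restrictScalars_mul', ← Node00.bondOpCoordsY_mul, deltaAQY_mul_GAQY hU, bondOpCoordsY_one]
  exact conj_one b

/-- `G[𝔮] · Δ_a[𝔮] = 1` in real bond coordinates wherever `Δ_a[𝔮]` is a unit. [cite: Balaban1985BackgroundPropagators, (3.27) p.395] -/
theorem GbQC_mul_conj_deltaAQY (c : CCfg (CfgY 𝔸 i) (AfldY 𝔸 i)) (hU : IsUnit (deltaAQY i 𝔮 𝔮s parS (GpY i parS) (decY i c))) :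
    GbQC i 𝔮 𝔮s parS b c * conj b ((bondOpCoordsY i (deltaAQY i 𝔮 𝔮s parS (GpY i parS) (decY i c))).restrictScalars ℝ) = 1 := by
  rw [GbQC, ← B9Eq352DivFormLetters.conj_mul, ← restrictScalars_mul', ← Node00.bondOpCoordsY_mul, GAQY_mul_deltaAQY hU, bondOpCoordsY_one]
  exact conj_one b

/-- ★ FIELD `reg_ginv` AT THE LETTERS: wherever `Δ_a[𝔮](decY c)` is a unit (displayed at (3.35)-regular G-valued bases: Thm 3.1's regime), the frames' `deltaA`
word times `GbQC c` is `1` on both sides. [cite: Balaban1985BackgroundPropagators, (3.27) p.395, Thm 3.3 p.399] -/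
theorem word_mul_GbQC (c : CCfg (CfgY 𝔸 i) (AfldY 𝔸 i)) (hU : IsUnit (deltaAQY i 𝔮 𝔮s parS (GpY i parS) (decY i c))) :
    deltaA (conj b (lapDDLetter (shiftY i) ((|i.cf| : ℝ) : ℂ) (UboxY i (decY i c))))
        (conj b (dPrimeLetter (shiftY i) (UboxY i (decY i c)) (|i.cf|⁻¹)))
        (conjHom b (gradLin (shiftY i) ((|i.cf| : ℝ) : ℂ) (UboxY i (decY i c))) ∘ₗ
            (1 - GopC i parS b c ∘ₗ QcsC i parS b c ∘ₗ CopC i parS b c ∘ₗ QcC i parS b c ∘ₗ GopC i parS b c) ∘ₗ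
          conjHom b (divLin (shiftY i) ((|i.cf| : ℝ) : ℂ) (UboxY i (decY i c))))
        (QsbQC i 𝔮s b c) (abC i b) (QbQC i 𝔮 b c) * GbQC i 𝔮 𝔮s parS b c = 1 ∧
    GbQC i 𝔮 𝔮s parS b c * deltaA (conj b (lapDDLetter (shiftY i) ((|i.cf| : ℝ) : ℂ) (UboxY i (decY i c))))
        (conj b (dPrimeLetter (shiftY i) (UboxY i (decY i c)) (|i.cf|⁻¹)))
        (conjHom b (gradLin (shiftY i) ((|i.cf| : ℝ) : ℂ) (UboxY i (decY i c))) ∘ₗ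
            (1 - GopC i parS b c ∘ₗ QcsC i parS b c ∘ₗ CopC i parS b c ∘ₗ QcC i parS b c ∘ₗ GopC i parS b c) ∘ₗ
          conjHom b (divLin (shiftY i) ((|i.cf| : ℝ) : ℂ) (UboxY i (decY i c))))
        (QsbQC i 𝔮s b c) (abC i b) (QbQC i 𝔮 b c) = 1 := by
  rw [← conj_deltaAQY_eq]
  exact ⟨conj_deltaAQY_mul_GbQC i 𝔮 𝔮s parS b c hU, GbQC_mul_conj_deltaAQY i 𝔮 𝔮s parS b c hU⟩

/-- ★ FIELD `gb_eq_cplx` AT THE LETTERS: if the frames' `deltaA` word at `decY c` has a two-sided inverse `X`, then `Δ_a[𝔮](decY c)` IS a unit and `GbC c = X` —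
«its inverse again by G» ((3.27)∕(3.86)): the word is `Δ_a[𝔮]` in coordinates (§3), a bijection; units of `Module.End` are the bijections; inverses are unique.
[cite: Balaban1985BackgroundPropagators, (3.27) p.395, (3.86) p.407] -/
theorem GbQC_eq_of_two_sided (c : CCfg (CfgY 𝔸 i) (AfldY 𝔸 i)) (X : Module.End ℝ ((Fin (d + 1) × SiteY i) × ι → ℝ))
    (hDX : deltaA (conj b (lapDDLetter (shiftY i) ((|i.cf| : ℝ) : ℂ) (UboxY i (decY i c))))
        (conj b (dPrimeLetter (shiftY i) (UboxY i (decY i c)) (|i.cf|⁻¹)))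
        (conjHom b (gradLin (shiftY i) ((|i.cf| : ℝ) : ℂ) (UboxY i (decY i c))) ∘ₗ
            (1 - GopC i parS b c ∘ₗ QcsC i parS b c ∘ₗ CopC i parS b c ∘ₗ QcC i parS b c ∘ₗ GopC i parS b c) ∘ₗ
          conjHom b (divLin (shiftY i) ((|i.cf| : ℝ) : ℂ) (UboxY i (decY i c))))
        (QsbQC i 𝔮s b c) (abC i b) (QbQC i 𝔮 b c) * X = 1)
    (hXD : X * deltaA (conj b (lapDDLetter (shiftY i) ((|i.cf| : ℝ) : ℂ) (UboxY i (decY i c))))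
        (conj b (dPrimeLetter (shiftY i) (UboxY i (decY i c)) (|i.cf|⁻¹)))
        (conjHom b (gradLin (shiftY i) ((|i.cf| : ℝ) : ℂ) (UboxY i (decY i c))) ∘ₗ
            (1 - GopC i parS b c ∘ₗ QcsC i parS b c ∘ₗ CopC i parS b c ∘ₗ QcC i parS b c ∘ₗ GopC i parS b c) ∘ₗ
          conjHom b (divLin (shiftY i) ((|i.cf| : ℝ) : ℂ) (UboxY i (decY i c))))
        (QsbQC i 𝔮s b c) (abC i b) (QbQC i 𝔮 b c) = 1) :
    IsUnit (deltaAQY i 𝔮 𝔮s parS (GpY i parS) (decY i c)) ∧ GbQC i 𝔮 𝔮s parS b c = X := by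
  rw [← conj_deltaAQY_eq] at hDX hXD
  set D := conj b ((bondOpCoordsY i (deltaAQY i 𝔮 𝔮s parS (GpY i parS) (decY i c))).restrictScalars ℝ) with hD
  -- `D` is bijective, hence so is `Δ_a[𝔮](decY c)`: the same function conjugated by the two coordinate changes
  have hbijD : Function.Bijective D := (Module.End.isUnit_iff D).1 ⟨⟨D, X, hDX, hXD⟩, rfl⟩
  have hTe : ((deltaAQY i 𝔮 𝔮s parS (GpY i parS) (decY i c)) : (FBondY i → 𝔸) → (FBondY i → 𝔸)) =
      (bondFunCoordsY i).symm ∘ (coordEquiv b).symm ∘ D ∘ (coordEquiv b) ∘ (bondFunCoordsY i) := by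
    funext f
    simp only [hD, Function.comp_apply, B9Eq352DivFormLetters.conj, LinearEquiv.conj_apply, LinearEquiv.coe_coe, LinearMap.comp_apply,
      LinearEquiv.symm_apply_apply, LinearMap.restrictScalars_apply, bondOpCoordsY_apply]
  have hbijΔ : Function.Bijective (deltaAQY i 𝔮 𝔮s parS (GpY i parS) (decY i c)) := by
    rw [hTe]
    exact (bondFunCoordsY i).symm.bijective.comp ((coordEquiv b).symm.bijective.comp (hbijD.comp
      ((coordEquiv b).bijective.comp (bondFunCoordsY i).bijective)))
  have hunit : IsUnit (deltaAQY i 𝔮 𝔮s parS (GpY i parS) (decY i c)) := (Module.End.isUnit_iff _).2 hbijΔ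
  refine ⟨hunit, ?_⟩
  have h1 : D * GbQC i 𝔮 𝔮s parS b c = 1 := conj_deltaAQY_mul_GbQC i 𝔮 𝔮s parS b c hunit
  calc GbQC i 𝔮 𝔮s parS b c = (X * D) * GbQC i 𝔮 𝔮s parS b c := by rw [hXD, one_mul]
    _ = X * (D * GbQC i 𝔮 𝔮s parS b c) := by rw [mul_assoc]
    _ = X := by rw [h1, mul_one]

/-! ## §4 The straight instance: at `(𝔮, 𝔮s) := (QY parB, QsY parB)` these ARE the letters of `B9SectBGWordDeltaAY` (`rfl`) -/

/-- FACE: `QbQY (QY parB) = QbY parB`. [cite: Balaban1985BackgroundPropagators, (3.12) p.393, bookkeeping] -/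
theorem QbQY_QY : QbQY i (QY i parB) = QbY i parB := rfl

/-- FACE: `QsbVQY (QsY parB) = QsbVY parB`. [cite: Balaban1985BackgroundPropagators, (3.13) p.393, bookkeeping] -/
theorem QsbVQY_QsY : QsbVQY i (QsY i parB) = QsbVY i parB := rfl

/-- FACE: `QbQC (QY parB) = QbC parB`. [cite: Balaban1985BackgroundPropagators, (3.12) p.393, bookkeeping] -/
theorem QbQC_QY : QbQC i (QY i parB) b = QbC i parB b := rfl

/-- FACE: `QsbQC (QsY parB) = QsbC parB`. [cite: Balaban1985BackgroundPropagators, (3.13) p.393, bookkeeping] -/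
theorem QsbQC_QsY : QsbQC i (QsY i parB) b = QsbC i parB b := rfl

/-- FACE: `GbQC (QY parB) (QsY parB) parS = GbC parS parB` ((3.27) at the straight letter, `GAQY_QY`). [cite: Balaban1985BackgroundPropagators, (3.27) p.395, bookkeeping] -/
theorem GbQC_QY : GbQC i (QY i parB) (QsY i parB) parS b = GbC i parS parB b := rfl

/-- FACE: `F₂QC (QY parB) = F₂C parB`. [cite: Balaban1985BackgroundPropagators, (3.80) p.406, bookkeeping] -/
theorem F₂QC_QY : F₂QC i (QY i parB) b = F₂C i parB b := by
  funext c c'; cases c <;> cases c' <;> rfl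

/-- FACE: `F₂sQC (QsY parB) = F₂sC parB`. [cite: Balaban1985BackgroundPropagators, (3.80) p.406, bookkeeping] -/
theorem F₂sQC_QsY : F₂sQC i (QsY i parB) b = F₂sC i parB b := by
  funext c c'; cases c <;> cases c' <;> rfl

end Literature.MathematicalPhysics.QuantumFieldTheory.Balaban1983to89.B9SectBGWordDeltaAQY

end
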